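import Summits.BirchSwinnertonDyer.BirchSwinnertonDyer.Theorems.UniversalToricDescentTwinChoiceKernelAtThree
import Summits.BirchSwinnertonDyer.BirchSwinnertonDyer.Theorems.UniversalToricDescentTwinChoiceDefs
import HarnessLib

/-!
# Route `UniversalToricDescent`, crux #3 children 20694 / 20695: the twin-choice kernel BY NAME
# (pointwise twin IMC `TwinIMCAtThreeAt`, the `a₃ = 0` half of bucket C, the `a₃ = 0`-twin supply)

Cell `bsd-wall` (W-ALL lane 3, row 2·3@3), seat `bsd-wall-utd-p2` g6, 2026-08-27. Pure logic joining the
twin-choice kernel (`UniversalToricDescentTwinChoiceKernelAtThree.lean`, p576995) with the route predicates of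
`UniversalToricDescentTwinChoiceDefs.lean`:

* `twinSplitIMCAtThreeGoodSS_iff` / `twinSplitIMCAtThreeMult_iff` — the bucket cruxes 20695 (C) / 20694 (B)
  are `∀ W′, GoodSS W′ 3 → ρ̄₃ onto → TwinIMCAtThreeAt W′` resp. `∀ W′, Mult W′ 3 → ρ̄₃ onto → TwinIMCAtThreeAt W′`
  (reordering of binders only).
* `bsdp_three_of_twinIMCAtThreeAt` — the POINTWISE kernel by name: `TwinIMCAtThreeAt W′` at the handed
  twin `W′` (with the route's other pieces) gives `BSD₃(E)`.
* `twinSplitIMCAtThreeGoodSS_of_apZero_of_apNonzero` / `…_iff_apZero_and_apNonzero` — LOSSLESS split of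
  item 20695 by `W′.frobeniusTrace 3 = 0` (the `a₃ = 0` half: port-shaped at `p = 3`; the `a₃ ≠ 0` half:
  no refereed mechanism).
* `wAllExclAddWildRankOneSurjTwin_of_apZero_of_supply` — the leaf BY NAME from the route's pieces with
  bucket C's crux replaced by its `a₃ = 0` half `∀ W′, GoodSS W′ 3 → W′.frobeniusTrace 3 = 0 → ρ̄₃ onto →
  TwinIMCAtThreeAt W′` and the SUPPLY `∀ W, HasGoodSSTwinAtThree W → HasGoodSSApZeroTwinAtThree W`; the
  `a₃ = ±3` half of 20695 and the even-`d_K` child 20696 do not enter.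

* §5 (appended): the same with the supply demanded only ON THE ATTACKED CELL (`ClassO6`, `r_an = 1`, onto) —
  `bsdp_three_of_apZero_of_cellSupply`, `wAllExclAddWildRankOneSurjTwin_of_apZero_of_cellSupply` — and the
  adapters showing that the ideation seat's typed shapes (utd-idea g9: `TwinSplitIMCAtThreeGoodSSZero`,
  `SSTraceFreedomAtThree`, displayed inline) feed it verbatim:
  `wAllExclAddWildRankOneSurjTwin_of_goodApZero_of_traceFreedom`.

HONEST FRAMING: conditional results, pure logic; nothing closes; BSD is not proved for any curve here.
Beyond-print theorem: NO.
-/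

set_option autoImplicit false
set_option linter.dupNamespace false

noncomputable section

open scoped Classical

namespace Summit.BirchSwinnertonDyer.BirchSwinnertonDyer.Theorems.UniversalToricDescentTwinChoice

open WeierstrassCurve NumberField IsDedekindDomain Field
  Literature.NumberTheory.EllipticCurves
  Literature.NumberTheory.EllipticCurves.ModularForms
  Literature.NumberTheory.EllipticCurves.Rank1Residual
  Summit.BirchSwinnertonDyer.Rank1Residual
  Summit.BirchSwinnertonDyer.Rank1Residual.X11b
  Summit.BirchSwinnertonDyer.Rank1Residual.X11b.AcSelmer
  Summit.BirchSwinnertonDyer.Rank1Residual.X11b.Halves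
  Summit.BirchSwinnertonDyer.BirchSwinnertonDyer.Theses.UniversalToricDescent
  Summit.BirchSwinnertonDyer.BirchSwinnertonDyer.Theorems

/-! ### §1. The bucket cruxes as `∀`-closures of the pointwise twin IMC -/

/-- **Item 20695 (bucket C) ⟺ `∀ W′, GoodSS W′ 3 → ρ̄₃ onto → TwinIMCAtThreeAt W′`** (binder reordering).
[folklore] -/
theorem twinSplitIMCAtThreeGoodSS_iff :
    TwinSplitIMCAtThreeGoodSS ↔ ∀ (W' : WeierstrassCurve ℚ) [W'.IsElliptic] [W'.IsGloballyMinimal],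
      GoodSS W' 3 → W'.HasSurjectiveModNGaloisRep 3 → TwinIMCAtThreeAt W' :=
  ⟨fun h W' _ _ hss hsurj N' _ K _ _ Dt' hN hK hH hodd κ hκ γ _ 𝔭 h𝔭 he hf 𝔭' h𝔭' hne ι' hι ↦
      h W' N' K Dt' hss hsurj hN hK hH hodd κ hκ γ 𝔭 h𝔭 he hf 𝔭' h𝔭' hne ι' hι,
    fun h W' _ _ N' _ K _ _ Dt' hss hsurj hN hK hH hodd κ hκ γ _ 𝔭 h𝔭 he hf 𝔭' h𝔭' hne ι' hι ↦
      h W' hss hsurj N' K Dt' hN hK hH hodd κ hκ γ 𝔭 h𝔭 he hf 𝔭' h𝔭' hne ι' hι⟩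

/-- **Item 20694 (bucket B) ⟺ `∀ W′, Mult W′ 3 → ρ̄₃ onto → TwinIMCAtThreeAt W′`** (binder reordering).
[folklore] -/
theorem twinSplitIMCAtThreeMult_iff :
    TwinSplitIMCAtThreeMult ↔ ∀ (W' : WeierstrassCurve ℚ) [W'.IsElliptic] [W'.IsGloballyMinimal],
      Mult W' 3 → W'.HasSurjectiveModNGaloisRep 3 → TwinIMCAtThreeAt W' :=
  ⟨fun h W' _ _ hm hsurj N' _ K _ _ Dt' hN hK hH hodd κ hκ γ _ 𝔭 h𝔭 he hf 𝔭' h𝔭' hne ι' hι ↦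
      h W' N' K Dt' hm hsurj hN hK hH hodd κ hκ γ 𝔭 h𝔭 he hf 𝔭' h𝔭' hne ι' hι,
    fun h W' _ _ N' _ K _ _ Dt' hm hsurj hN hK hH hodd κ hκ γ _ 𝔭 h𝔭 he hf 𝔭' h𝔭' hne ι' hι ↦
      h W' hm hsurj N' K Dt' hN hK hH hodd κ hκ γ 𝔭 h𝔭 he hf 𝔭' h𝔭' hne ι' hι⟩

/-! ### §2. The pointwise kernel by name -/

/-- **Pointwise kernel, by name**: published inputs, transport, Waldspurger frame, control, rank-zero twist,
and `TwinIMCAtThreeAt W′` at the handed semistable twin `W′` ⟹ `BSD₃(E)` (= p576995 §1, whose inline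
pointwise hypothesis is `TwinIMCAtThreeAt W′` unfolded). [folklore] -/
theorem bsdp_three_of_twinIMCAtThreeAt (hF : ToricPublishedInputs) (hT : ToricTransportModThree)
    (hV : WildSplitWaldspurgerAtThree) (hC : WildSplitControlAtThree) (hZ : WildRankZeroTwistAtThree)
    (W : WeierstrassCurve ℚ) [W.IsElliptic] [W.IsGloballyMinimal]
    (hO6 : Additive.ClassO6 W 3) (hr : W.analyticRank = 1) (hsurj : W.HasSurjectiveModNGaloisRep 3)
    (W' : WeierstrassCurve ℚ) [W'.IsElliptic] [W'.IsGloballyMinimal]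
    (hcong : O6.ModPCongruent W' W 3) (hW'ss : ¬ Addv W' 3) (hI : TwinIMCAtThreeAt W') : BSDp W 3 :=
  bsdp_three_of_twinIMCAt hF hT hV hC hZ W hO6 hr hsurj W' hcong hW'ss hI

/-! ### §3. The lossless split of item 20695 by `a₃` -/

/-- **Split of item 20695**: its `a₃ = 0` half and its `a₃ ≠ 0` half give it back (excluded middle on
`W′.frobeniusTrace 3 = 0`). [folklore] -/
theorem twinSplitIMCAtThreeGoodSS_of_apZero_of_apNonzero
    (h0 : ∀ (W' : WeierstrassCurve ℚ) [W'.IsElliptic] [W'.IsGloballyMinimal],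
      GoodSS W' 3 → W'.frobeniusTrace 3 = 0 → W'.HasSurjectiveModNGaloisRep 3 → TwinIMCAtThreeAt W')
    (h1 : ∀ (W' : WeierstrassCurve ℚ) [W'.IsElliptic] [W'.IsGloballyMinimal],
      GoodSS W' 3 → W'.frobeniusTrace 3 ≠ 0 → W'.HasSurjectiveModNGaloisRep 3 → TwinIMCAtThreeAt W') :
    TwinSplitIMCAtThreeGoodSS := by
  refine twinSplitIMCAtThreeGoodSS_iff.2 fun W' _ _ hss hsurj ↦ ?_
  by_cases ha : W'.frobeniusTrace 3 = 0
  · exact h0 W' hss ha hsurj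
  · exact h1 W' hss ha hsurj

/-- **Item 20695 ⟺ its `a₃ = 0` half ∧ its `a₃ ≠ 0` half.** [folklore] -/
theorem twinSplitIMCAtThreeGoodSS_iff_apZero_and_apNonzero :
    TwinSplitIMCAtThreeGoodSS ↔
      (∀ (W' : WeierstrassCurve ℚ) [W'.IsElliptic] [W'.IsGloballyMinimal],
        GoodSS W' 3 → W'.frobeniusTrace 3 = 0 → W'.HasSurjectiveModNGaloisRep 3 → TwinIMCAtThreeAt W') ∧
      (∀ (W' : WeierstrassCurve ℚ) [W'.IsElliptic] [W'.IsGloballyMinimal],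
        GoodSS W' 3 → W'.frobeniusTrace 3 ≠ 0 → W'.HasSurjectiveModNGaloisRep 3 → TwinIMCAtThreeAt W') :=
  ⟨fun h ↦ ⟨fun W' _ _ hss _ hsurj ↦ twinSplitIMCAtThreeGoodSS_iff.1 h W' hss hsurj,
      fun W' _ _ hss _ hsurj ↦ twinSplitIMCAtThreeGoodSS_iff.1 h W' hss hsurj⟩,
    fun ⟨h0, h1⟩ ↦ twinSplitIMCAtThreeGoodSS_of_apZero_of_apNonzero h0 h1⟩

/-! ### §4. The leaf with bucket C restricted to `a₃ = 0`, granted the supply — by name -/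

/-- **The leaf BY NAME with bucket C's crux restricted to `a₃ = 0`, granted the supply of an `a₃ = 0`
twin**: published inputs, transport, printed facts (bucket A) with the closed child
`TwinSplitIMCAtThreeGoodOrdOfPrint`, bucket B's crux `TwinSplitIMCAtThreeMult`, the `a₃ = 0` half of bucket
C, the supply `∀ W, HasGoodSSTwinAtThree W → HasGoodSSApZeroTwinAtThree W`, Waldspurger frame, control,
rank-zero twist ⟹ `WAllExclAddWildRankOneSurjTwin`. The `a₃ = ±3` half of item 20695 and the even-`d_K`
child 20696 do not enter. [folklore] -/
theorem wAllExclAddWildRankOneSurjTwin_of_apZero_of_supply (hF : ToricPublishedInputs)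
    (hT : ToricTransportModThree) (hP : TwinSplitIMCAtThreePrintedFacts)
    (hA : TwinSplitIMCAtThreeGoodOrdOfPrint) (hB : TwinSplitIMCAtThreeMult)
    (hS0 : ∀ (W' : WeierstrassCurve ℚ) [W'.IsElliptic] [W'.IsGloballyMinimal],
      GoodSS W' 3 → W'.frobeniusTrace 3 = 0 → W'.HasSurjectiveModNGaloisRep 3 → TwinIMCAtThreeAt W')
    (hsupply : ∀ (W : WeierstrassCurve ℚ) [W.IsElliptic] [W.IsGloballyMinimal],
      HasGoodSSTwinAtThree W → HasGoodSSApZeroTwinAtThree W)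
    (hV : WildSplitWaldspurgerAtThree) (hC : WildSplitControlAtThree) (hZ : WildRankZeroTwistAtThree) :
    Summit.BirchSwinnertonDyer.WAllExclAddWildRankOneSurjTwin :=
  wAllExclAddWildRankOneSurjTwin_of_oddDiscBuckets_of_goodSSApZero_of_supply hF hT hP hA hB
    (fun W' _ _ N' _ K _ _ Dt' hss ha hsurj hN hK hH hodd κ hκ γ _ 𝔭 h𝔭 he hf 𝔭' h𝔭' hne ι' hι ↦
      hS0 W' hss ha hsurj N' K Dt' hN hK hH hodd κ hκ γ 𝔭 h𝔭 he hf 𝔭' h𝔭' hne ι' hι)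
    (fun W _ _ W' _ _ hcong hss ↦ hsupply W ⟨W', ‹_›, ‹_›, hcong, hss⟩) hV hC hZ

/-- The same, reading the kernel's conclusion (every curve of the attacked cell gets `BSD₃`) instead of
the leaf. [folklore] -/
theorem bsdp_three_of_apZero_of_supply (hF : ToricPublishedInputs)
    (hT : ToricTransportModThree) (hP : TwinSplitIMCAtThreePrintedFacts)
    (hA : TwinSplitIMCAtThreeGoodOrdOfPrint) (hB : TwinSplitIMCAtThreeMult)
    (hS0 : ∀ (W' : WeierstrassCurve ℚ) [W'.IsElliptic] [W'.IsGloballyMinimal],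
      GoodSS W' 3 → W'.frobeniusTrace 3 = 0 → W'.HasSurjectiveModNGaloisRep 3 → TwinIMCAtThreeAt W')
    (hsupply : ∀ (W : WeierstrassCurve ℚ) [W.IsElliptic] [W.IsGloballyMinimal],
      HasGoodSSTwinAtThree W → HasGoodSSApZeroTwinAtThree W)
    (hV : WildSplitWaldspurgerAtThree) (hC : WildSplitControlAtThree) (hZ : WildRankZeroTwistAtThree) :
    ∀ (W : WeierstrassCurve ℚ) [W.IsElliptic] [W.IsGloballyMinimal], Additive.ClassO6 W 3 →
      W.analyticRank = 1 → W.HasSurjectiveModNGaloisRep 3 →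
      (∃ (W' : WeierstrassCurve ℚ) (_ : W'.IsElliptic) (_ : W'.IsGloballyMinimal),
        O6.ModPCongruent W' W 3 ∧ ¬ Addv W' 3 ∧ W'.HasSurjectiveModNGaloisRep 3) → BSDp W 3 :=
  bsdp_three_of_oddDiscBuckets_of_goodSSApZero_of_supply hF hT hP hA hB
    (fun W' _ _ N' _ K _ _ Dt' hss ha hsurj hN hK hH hodd κ hκ γ _ 𝔭 h𝔭 he hf 𝔭' h𝔭' hne ι' hι ↦
      hS0 W' hss ha hsurj N' K Dt' hN hK hH hodd κ hκ γ 𝔭 h𝔭 he hf 𝔭' h𝔭' hne ι' hι)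
    (fun W _ _ W' _ _ hcong hss ↦ hsupply W ⟨W', ‹_›, ‹_›, hcong, hss⟩) hV hC hZ


/-! ### §5. (appended) The supply RESTRICTED TO THE ATTACKED CELL, and utd-idea g9's typed shapes

The kernel needs the `a₃ = 0` twin only for curves `W` of the attacked cell (`ClassO6 W 3`, `r_an = 1`, `ρ̄₃`
onto), so the supply hypothesis may carry these binders (a WEAKER hypothesis than §4's). In this form it is
implied verbatim by the ideation seat's typed `SSTraceFreedomAtThree` (utd-idea g9, Sketch-utd-idea-g9.lean §2,
taken at `a = 0`; displayed inline below since that sketch is not a tree module), and the `a₃ = 0` half may be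
displayed in the «good ∧ `a₃ = 0`» shape of its `TwinSplitIMCAtThreeGoodSSZero` (§3 there). -/

/-- The `a₃ = 0` half in «good ∧ `a₃ = 0`» shape ⟺ in «`GoodSS` ∧ `a₃ = 0`» shape (`3 ∣ 0`). [folklore] -/
theorem apZeroHalf_iff_goodApZeroHalf :
    (∀ (W' : WeierstrassCurve ℚ) [W'.IsElliptic] [W'.IsGloballyMinimal],
      GoodSS W' 3 → W'.frobeniusTrace 3 = 0 → W'.HasSurjectiveModNGaloisRep 3 → TwinIMCAtThreeAt W') ↔
    (∀ (W' : WeierstrassCurve ℚ) [W'.IsElliptic] [W'.IsGloballyMinimal],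
      W'.HasGoodReductionAtPrime 3 → W'.frobeniusTrace 3 = 0 → W'.HasSurjectiveModNGaloisRep 3 →
        TwinIMCAtThreeAt W') :=
  ⟨fun h W' _ _ hg ha hs ↦ h W' ⟨hg, by rw [ha]; exact dvd_zero _⟩ ha hs,
    fun h W' _ _ hss ha hs ↦ h W' hss.1 ha hs⟩

/-- **Kernel conclusion from the `a₃ = 0` half of bucket C and the supply ON THE CELL** (`ClassO6 W 3`,
`r_an = 1`, `ρ̄₃` onto ⟹ a good-supersingular twin can be traded for one with `a₃ = 0`): trichotomy of the handed
twin at `3`, the good-supersingular case re-keyed to the supplied `a₃ = 0` twin (onto by transport from `W`, good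
hence not additive), then the pointwise kernel `bsdp_three_of_twinIMCAtThreeAt`. [folklore] -/
theorem bsdp_three_of_apZero_of_cellSupply (hF : ToricPublishedInputs)
    (hT : ToricTransportModThree) (hP : TwinSplitIMCAtThreePrintedFacts)
    (hA : TwinSplitIMCAtThreeGoodOrdOfPrint) (hB : TwinSplitIMCAtThreeMult)
    (hS0 : ∀ (W' : WeierstrassCurve ℚ) [W'.IsElliptic] [W'.IsGloballyMinimal],
      GoodSS W' 3 → W'.frobeniusTrace 3 = 0 → W'.HasSurjectiveModNGaloisRep 3 → TwinIMCAtThreeAt W')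
    (hsupply : ∀ (W : WeierstrassCurve ℚ) [W.IsElliptic] [W.IsGloballyMinimal], Additive.ClassO6 W 3 →
      W.analyticRank = 1 → W.HasSurjectiveModNGaloisRep 3 → HasGoodSSTwinAtThree W →
      HasGoodSSApZeroTwinAtThree W)
    (hV : WildSplitWaldspurgerAtThree) (hC : WildSplitControlAtThree) (hZ : WildRankZeroTwistAtThree) :
    ∀ (W : WeierstrassCurve ℚ) [W.IsElliptic] [W.IsGloballyMinimal], Additive.ClassO6 W 3 →
      W.analyticRank = 1 → W.HasSurjectiveModNGaloisRep 3 →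
      (∃ (W' : WeierstrassCurve ℚ) (_ : W'.IsElliptic) (_ : W'.IsGloballyMinimal),
        O6.ModPCongruent W' W 3 ∧ ¬ Addv W' 3 ∧ W'.HasSurjectiveModNGaloisRep 3) → BSDp W 3 := by
  intro W _ _ hO6 hr hsurj htwin
  obtain ⟨W', hW'e, hW'm, hcong, hW'ss, hW'surj⟩ := htwin
  by_cases hgood : W'.HasGoodReductionAtPrime 3
  · by_cases hss : (3 : ℤ) ∣ W'.frobeniusTrace 3
    · -- good supersingular: trade `W′` for the supplied `a₃ = 0` twin `W″`
      obtain ⟨W'', hW''e, hW''m, hcong'', hW''ss, ha0⟩ :=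
        hsupply W hO6 hr hsurj ⟨W', hW'e, hW'm, hcong, hgood, by exact_mod_cast hss⟩
      have hW''surj : W''.HasSurjectiveModNGaloisRep 3 := by
        obtain ⟨e, he⟩ := hcong''
        refine GaloisImage.hasSurjectiveModNGaloisRep_of_torsionIso e.symm (fun σ Q ↦ ?_) hsurj
        apply e.injective
        rw [he, e.apply_symm_apply, e.apply_symm_apply]
      exact bsdp_three_of_twinIMCAtThreeAt hF hT hV hC hZ W hO6 hr hsurj W'' hcong'' (fun h ↦ h.1 hW''ss.1)
        (hS0 W'' hW''ss ha0 hW''surj)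
    · -- good ordinary: bucket A by the printed facts through the closed child
      refine bsdp_three_of_twinIMCAt hF hT hV hC hZ W hO6 hr hsurj W' hcong hW'ss ?_
      intro N' _ K _ _ Dt' hN hK hH hodd κ hκ γ _ 𝔭 h𝔭 he hf 𝔭' h𝔭' hne ι' hι
      exact hA hP.1 hP.2.1 hP.2.2 W' N' K Dt' ⟨hgood, by exact_mod_cast hss⟩ hW'surj hN hK hH hodd κ
        hκ γ 𝔭 h𝔭 he hf 𝔭' h𝔭' hne ι' hι
  · -- multiplicative: bucket B
    have hmult : W'.HasMultiplicativeReductionAtPrime 3 := by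
      by_contra h
      exact hW'ss ⟨hgood, h⟩
    exact bsdp_three_of_twinIMCAtThreeAt hF hT hV hC hZ W hO6 hr hsurj W' hcong hW'ss
      (twinSplitIMCAtThreeMult_iff.1 hB W' hmult hW'surj)

/-- **The leaf BY NAME from the `a₃ = 0` half of bucket C and the supply ON THE CELL.** [folklore] -/
theorem wAllExclAddWildRankOneSurjTwin_of_apZero_of_cellSupply (hF : ToricPublishedInputs)
    (hT : ToricTransportModThree) (hP : TwinSplitIMCAtThreePrintedFacts)
    (hA : TwinSplitIMCAtThreeGoodOrdOfPrint) (hB : TwinSplitIMCAtThreeMult)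
    (hS0 : ∀ (W' : WeierstrassCurve ℚ) [W'.IsElliptic] [W'.IsGloballyMinimal],
      GoodSS W' 3 → W'.frobeniusTrace 3 = 0 → W'.HasSurjectiveModNGaloisRep 3 → TwinIMCAtThreeAt W')
    (hsupply : ∀ (W : WeierstrassCurve ℚ) [W.IsElliptic] [W.IsGloballyMinimal], Additive.ClassO6 W 3 →
      W.analyticRank = 1 → W.HasSurjectiveModNGaloisRep 3 → HasGoodSSTwinAtThree W →
      HasGoodSSApZeroTwinAtThree W)
    (hV : WildSplitWaldspurgerAtThree) (hC : WildSplitControlAtThree) (hZ : WildRankZeroTwistAtThree) :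
    Summit.BirchSwinnertonDyer.WAllExclAddWildRankOneSurjTwin :=
  Summit.BirchSwinnertonDyer.wAllExclAddWildRankOneSurjTwin_of_forall
    (bsdp_three_of_apZero_of_cellSupply hF hT hP hA hB hS0 hsupply hV hC hZ)

/-- **utd-idea g9's `SSTraceFreedomAtThree` (displayed inline, verbatim shape) at `a = 0` ⟹ the supply on
the cell** (even without the `r_an = 1` binder). [folklore] -/
theorem cellSupply_of_traceFreedom
    (hfree : ∀ (W : WeierstrassCurve ℚ) [W.IsElliptic] [W.IsGloballyMinimal],
      Additive.ClassO6 W 3 → W.HasSurjectiveModNGaloisRep 3 →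
      (∃ (W' : WeierstrassCurve ℚ) (_ : W'.IsElliptic) (_ : W'.IsGloballyMinimal),
          O6.ModPCongruent W' W 3 ∧ GoodSS W' 3) →
      ∀ a : ℤ, (a = 0 ∨ a = 3 ∨ a = -3) →
      ∃ (W'' : WeierstrassCurve ℚ) (_ : W''.IsElliptic) (_ : W''.IsGloballyMinimal),
        O6.ModPCongruent W'' W 3 ∧ W''.HasGoodReductionAtPrime 3 ∧ W''.frobeniusTrace 3 = a ∧
          W''.HasSurjectiveModNGaloisRep 3) :
    ∀ (W : WeierstrassCurve ℚ) [W.IsElliptic] [W.IsGloballyMinimal], Additive.ClassO6 W 3 →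
      W.analyticRank = 1 → W.HasSurjectiveModNGaloisRep 3 → HasGoodSSTwinAtThree W →
      HasGoodSSApZeroTwinAtThree W := by
  intro W _ _ hO6 _ hsurj htwin
  obtain ⟨W'', i1, i2, hc, hg, h0, -⟩ := hfree W hO6 hsurj htwin 0 (Or.inl rfl)
  exact ⟨W'', i1, i2, hc, ⟨hg, by rw [h0]; exact dvd_zero _⟩, h0⟩

/-- **The leaf BY NAME from the `a₃ = 0` half (in «good ∧ `a₃ = 0`» shape) and utd-idea g9's
`SSTraceFreedomAtThree` shape** — the two seats' S1 re-keying, kernel-certified end to end. [folklore] -/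
theorem wAllExclAddWildRankOneSurjTwin_of_goodApZero_of_traceFreedom (hF : ToricPublishedInputs)
    (hT : ToricTransportModThree) (hP : TwinSplitIMCAtThreePrintedFacts)
    (hA : TwinSplitIMCAtThreeGoodOrdOfPrint) (hB : TwinSplitIMCAtThreeMult)
    (hS0 : ∀ (W' : WeierstrassCurve ℚ) [W'.IsElliptic] [W'.IsGloballyMinimal],
      W'.HasGoodReductionAtPrime 3 → W'.frobeniusTrace 3 = 0 → W'.HasSurjectiveModNGaloisRep 3 →
        TwinIMCAtThreeAt W')
    (hfree : ∀ (W : WeierstrassCurve ℚ) [W.IsElliptic] [W.IsGloballyMinimal],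
      Additive.ClassO6 W 3 → W.HasSurjectiveModNGaloisRep 3 →
      (∃ (W' : WeierstrassCurve ℚ) (_ : W'.IsElliptic) (_ : W'.IsGloballyMinimal),
          O6.ModPCongruent W' W 3 ∧ GoodSS W' 3) →
      ∀ a : ℤ, (a = 0 ∨ a = 3 ∨ a = -3) →
      ∃ (W'' : WeierstrassCurve ℚ) (_ : W''.IsElliptic) (_ : W''.IsGloballyMinimal),
        O6.ModPCongruent W'' W 3 ∧ W''.HasGoodReductionAtPrime 3 ∧ W''.frobeniusTrace 3 = a ∧
          W''.HasSurjectiveModNGaloisRep 3)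
    (hV : WildSplitWaldspurgerAtThree) (hC : WildSplitControlAtThree) (hZ : WildRankZeroTwistAtThree) :
    Summit.BirchSwinnertonDyer.WAllExclAddWildRankOneSurjTwin :=
  wAllExclAddWildRankOneSurjTwin_of_apZero_of_cellSupply hF hT hP hA hB
    (apZeroHalf_iff_goodApZeroHalf.2 hS0) (cellSupply_of_traceFreedom hfree) hV hC hZ

end Summit.BirchSwinnertonDyer.BirchSwinnertonDyer.Theorems.UniversalToricDescentTwinChoice

end
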